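import Mathlib
import Summits.QuantumFields.YangMills.Theorems.CoarseStiffnessTailCappedCoarseStiffnessLUnitLatticeStubs
import Summits.QuantumFields.YangMills.Theorems.CoarseStiffnessTailCappedCoarseStiffnessLWedgeFloor

/-!
# Route `CoarseStiffnessTail` — THE WEAKEST TOP-SLICE FORMS OF THE EDGE STUB THAT STILL CLOSE `HistoryTailL`: the unit-lattice large-field
# count WITH LOGARITHMIC SLACK (`S1_log`) and its HISTORY-WEDGE form (`S1_wedge`); kernel glue to 19936 and 27959 by name
# (lead's certificate, seat `ym-line-cst-p1` g21; helper on crux stmt-QuantumFields-25301)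

Notation.  Run `K` of the family `F` (block size `L`, volume exponent `m`): finest lattice `2L^{m+K}` sites per direction, Wilson law `Gibbs_K`
at `β_K = (γL^{-K})⁻¹`; `Ū^{K}` = the `K`-fold (0.4)-block-averaged field = a field on the UNIT lattice (`2L^m` sites per direction);
`p = B10.pFun b₀ p₀`, `θ_γ(h) = θBal L γ b₀ p₀ h = g_h·p(g_h)`, `g_h² = γL^{-h}`; `N_K(U) = #{unit plaquettes a : θ_γ(0) ≤ |Ū^{K}(∂a) − 1|}`.

The registered skeleton v9 of the crux `CappedCoarseStiffnessL` (stmt-QuantumFields-25301) has two open stubs (g20, `…LUnitLatticeStubs`):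
the EDGE `stub_unitLargeFieldCount` (S1_top: `∀ L b₀ p₀ ∃ c₀ C₀ γ₁ ∀ F γ K, ∫ exp(c₀·p(√γ)²·N_K) dGibbs_K ≤ e^{C₀·#Plaq_K}`) and the BULK
`stub_unitSubThresholdStiffness` (S2_top).  Only the EDGE is read by the route's consumer: S1_top ⇔ UniformLargeFieldCount (g20) ⇒ LargeFieldCount
(g5) ⇒ `UnitScaleTilt.HistoryTailL` (stmt-QuantumFields-19936).  THIS FILE records, definition-free and by name, the two WEAKER top-slice
statements that still close 19936 (and the organ's floor `HistoryWedge.WedgeTailL`, stmt-QuantumFields-27959), for the planners' re-type of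
25301 and for a siege:

* S1_log (UnitLargeFieldCountLog) — S1_top with a LOGARITHMIC SLACK `A·log γ⁻¹` per unit plaquette in the exponent:
    `∀ L b₀ p₀ ∃ c₀ C₀ γ₁ A ∀ F γ K: ∫ exp(c₀·p(√γ)²·N_K) dGibbs_K ≤ exp((C₀ + A·log γ⁻¹)·#Plaq_K)`.
  One quantifier block, uniform in `(K, m, γ ≤ γ₁)`.  The slack is free downstream (`p(g)² ≫ log g⁻²`: the per-plaquette schema of
  `T3AveragedTailProfile` carries a `β^{A}` prefactor) and it is exactly the precision of printed ultraviolet-stability constants, whose `O(1)`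
  per site at the last step contains `d(𝔤)·log g_K` ([Balaban1985UV3] (62), (65); audit reading in `…Balaban1983to89.B10`).
  §1 `largeFieldCount_of_unitLargeFieldCountLog` (refinement transport, g20's `integral_exp_plaqFun_eq_refine`: height `j` of run `j + d` of `F` at
  `γ` is the top of run `j` of `F.refine d` at `γL^{-d}`, and `log β_{K−j} = log (γL^{-d})⁻¹` is the transported slack);
  §2 `historyTailL_of_unitLargeFieldCountLog`, `wedgeTailL_of_unitLargeFieldCountLog` (BY NAME);
  §3 `unitLargeFieldCountLog_of_unitLargeFieldCount` (S1_top ⇒ S1_log, `A = 0`), `unitLargeFieldCountLog_of_cappedCoarseStiffnessL` (the crux ⇒ S1_log),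
  and `historyTailL_of_unitLargeFieldCount` — THE REGISTERED EDGE STUB ALONE CLOSES 19936's DECL (the BULK stub S2_top is not read).
* S1_wedge (UnitLargeFieldCountWedge) — S1_log demanded only where the consumer reads it: for the top fraction `m` of `HistoryTailAt`, only
  cut-offs `j` and couplings `γ ≤ γ₁L^{-d}` with `j + d ≤ m·(d + 1)` (the HISTORY WEDGE `K ≤ m(K − j + 1)` of run `K = j + d` at height `j`,
  ruling idea-crit-5 #105; g7's `…LWedgeFloor`) and only `d ≥ i₀`:
    `∀ L b₀ p₀ m ∃ c₀ C₀ γ₁ A i₀ ∀ F γ d j, γ ≤ γ₁L^{-d} → i₀ ≤ d → j + d ≤ m(d+1) → ∫ exp(c₀·p(√γ)²·N_j) dGibbs_j ≤ exp((C₀ + A·log γ⁻¹)·#Plaq_j)`.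
  READING: at most `(m − 1)(d + 1)` averaging steps at a top coupling `≤ γ₁L^{-d}` — every plaquette the consumer reads lives at physical scales
  `≤ L·ε_K^{1/m}`, where every running coupling is `≤ γ₁L^{1−K/m}`; the unit scale itself is never read.
  §4 `largeFieldCountW_of_unitLargeFieldCountWedge` (transport on the wedge), `historyTailL_of_unitLargeFieldCountWedge`,
  `wedgeTailL_of_unitLargeFieldCountWedge`, `unitLargeFieldCountWedge_of_unitLargeFieldCountLog` (S1_log ⇒ S1_wedge).

Kernel partial order recorded here (all by name, nothing else claimed):
  `CappedCoarseStiffnessL (25301) ⇒ S1_top ⇒ S1_log ⇒ S1_wedge ⇒ LargeFieldCountW ⇒ {UnitScaleTilt.HistoryTailL (19936), HistoryWedge.WedgeTailL (27959)}`.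
§5 (appended): the re-typed route's deciding theorems, kernel-checked — `UnitScaleTilt.closes` fed with the residual cruxes 19200/20520 and with
S1_log / S1_top / S1_wedge in place of `HistoryTailL` concludes the rung-R3 leaf `YM3TorusSU2` (CONDITIONAL on three open hypotheses; not Clay).

HONEST SCOPE.  Bookkeeping and transport over landed certificates; NO Gibbs integral is estimated; S1_top, S1_log, S1_wedge, the crux 25301,
`HistoryTailL` 19936, `WedgeTailL` 27959 and every rung above stay OPEN (their common content is [Balaban1985UV3] (71) p.273 at the last
renormalisation steps, summed over large-field sets and integrated against the Gibbs law, uniformly in the cut-off); `YM3TorusSU2` (rung R3, a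
RECORD rung, not the Clay statement) is NOT proved; the Yang–Mills mass gap is NOT touched.

References: T. Bałaban, CMP **102** (1985) 255–275 [Balaban1985UV3] ((1)–(3) p.256, (7) p.257, (62)/(65) p.271, (71) p.273); C. King, CMP **103**
(1986) 323–349 [King1986] ((3.12) p.657: the free top fraction); J. Fröhlich, R. Israel, E. Lieb, B. Simon, CMP **62** (1978) 1–34
[FrohlichIsraelLiebSimon1978] (Thm 4.1: chessboard, used inside the imported glue).
-/

noncomputable section

namespace Summit.QuantumFields.YangMills.Theorems.CoarseStiffnessTailUnitCountLogSlack

open MeasureTheory Finset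
open Literature.MathematicalPhysics.QuantumFieldTheory
open Literature.MathematicalPhysics.QuantumFieldTheory.Balaban1983to89
open Literature.MathematicalPhysics.QuantumFieldTheory.Balaban1983to89.T3ContinuumYM3Torus
open Literature.MathematicalPhysics.QuantumFieldTheory.Balaban1983to89.T3UnitScaleTilt
open Literature.MathematicalPhysics.QuantumFieldTheory.Balaban1983to89.T3UnitLawDensityEML
open Summit.QuantumFields.YangMills.Theorems.CoarseStiffnessTailUnitSlice (card_plaq_eq_refine θBal_eq_θBal_refine_zero)
open Summit.QuantumFields.YangMills.Theorems.CoarseStiffnessTailUnitLatticeStubs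
  (integral_exp_plaqFun_eq_refine coupling_refine_pos_le unitStubs_of_cappedCoarseStiffnessL)
open Summit.QuantumFields.YangMills.Theorems.CoarseStiffnessTailLargeFieldCountGlue (historyTailL_of_largeFieldCount)
open Summit.QuantumFields.YangMills.Theorems.CoarseStiffnessTailWedgeFloor
  (historyTailL_of_largeFieldCountW wedgeTailL_of_largeFieldCountW largeFieldCountW_of_largeFieldCount)

/-! ## §1 S1_log ⇒ LargeFieldCount (refinement transport; the slack `log γ'⁻¹` at the top of `F.refine d` is `log β_{K−j}` at height `j`) -/

section Log

/-- ★ **S1_log ⇒ LargeFieldCount** (g5's hypothesis of `historyTailL_of_largeFieldCount`, with its logarithmic slack `A·log β_{K−j}` and constants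
allowed per `(F, γ)` — here they come out uniform): at height `j` of run `K = j + d` of `F` at coupling `γ`, the count integral IS the top-slice
count integral of run `j` of `F.refine d` at coupling `γL^{-d}` (`integral_exp_plaqFun_eq_refine` with `g = 1[θ ≤ dist1]`; windows
`θ_γ(d) = θ_{γL^{-d}}(0)`, plaquette counts agree), `0 < γL^{-d} ≤ γ ≤ γ₁` is admissible, and the slack transports verbatim:
`log (γL^{-d})⁻¹ = log β_{K−j}`. [cite: Balaban1985UV3, (1)-(3) p.256 and (71) p.273] -/
theorem largeFieldCount_of_unitLargeFieldCountLog
    (h : ∀ (L : ℕ) (b₀ p₀ : ℝ), 0 < b₀ → 2 < p₀ → ∃ (c₀ C₀ γ₁ : ℝ) (A : ℕ), 0 < c₀ ∧ 0 < γ₁ ∧ γ₁ ≤ 1 ∧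
      ∀ (F : T3Family) (γ : ℝ), F.L = L → 0 < γ → γ ≤ γ₁ → ∀ (K : ℕ),
        ∫ U, Real.exp (c₀ * B10.pFun b₀ p₀ (Real.sqrt γ) ^ 2 *
            ∑ a : Plaq (F.P K) K, (if T3UnitScaleTilt.θBal F.L γ b₀ p₀ 0 ≤ GaugeGroup.dist1 (GaugeField.plaqHol
              (Averaging.iter (fun i => BlockAveraging.blockAvg (P := F.P K) (j := i) T3UnitLawDensityEML.ℰp) K U) a)
              then (1 : ℝ) else 0)) ∂(T3UnitScaleTilt.gibbsK F T3UnitLawDensityEML.ℰp γ K) ≤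
          Real.exp ((C₀ + A * Real.log γ⁻¹) * (Fintype.card (Plaq (F.P K) K) : ℝ))) :
    ∀ (L : ℕ) (b₀ p₀ : ℝ), 0 < b₀ → 2 < p₀ → ∃ γ₁ : ℝ, 0 < γ₁ ∧ γ₁ ≤ 1 ∧
      ∀ (F : T3Family) (γ : ℝ), F.L = L → 0 < γ → γ ≤ γ₁ → ∃ (c₀ C₀ : ℝ) (A : ℕ), 0 < c₀ ∧
        ∀ (K j : ℕ), j ≤ K →
          ∫ U, Real.exp (c₀ * B10.pFun b₀ p₀ (Real.sqrt (γ * ((F.L : ℝ)⁻¹) ^ (K - j))) ^ 2 *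
              ∑ a : Plaq (F.P K) j, (if T3UnitScaleTilt.θBal F.L γ b₀ p₀ (K - j) ≤ GaugeGroup.dist1 (GaugeField.plaqHol
                (Averaging.iter (fun i => BlockAveraging.blockAvg (P := F.P K) (j := i) T3UnitLawDensityEML.ℰp) j U) a)
                then (1 : ℝ) else 0)) ∂(T3UnitScaleTilt.gibbsK F T3UnitLawDensityEML.ℰp γ K) ≤
            Real.exp ((C₀ + A * Real.log ((γ * ((F.L : ℝ)⁻¹) ^ (K - j))⁻¹)) * (Fintype.card (Plaq (F.P K) j) : ℝ)) := by
  intro L b₀ p₀ hb₀ hp₀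
  obtain ⟨c₀, C₀, γ₁, A, hc₀, hγ₁, hγ₁1, hTop⟩ := h L b₀ p₀ hb₀ hp₀
  refine ⟨γ₁, hγ₁, hγ₁1, fun F γ hFL hγ hγγ₁ => ⟨c₀, C₀, A, hc₀, fun K j hjK => ?_⟩⟩
  obtain ⟨d, rfl⟩ := Nat.exists_eq_add_of_le hjK
  obtain ⟨hγ', hγ'le⟩ := coupling_refine_pos_le F hγ d
  have key := hTop (F.refine d) (γ * ((F.L : ℝ)⁻¹) ^ d) hFL hγ' (hγ'le.trans hγγ₁) j
  rw [Nat.add_sub_cancel_left,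
    integral_exp_plaqFun_eq_refine F hγ.le _ (fun u => if T3UnitScaleTilt.θBal F.L γ b₀ p₀ d ≤ GaugeGroup.dist1 u then (1 : ℝ) else 0),
    card_plaq_eq_refine, θBal_eq_θBal_refine_zero F.L γ b₀ p₀ d]
  exact key

/-! ## §2 S1_log ⇒ `UnitScaleTilt.HistoryTailL` (19936) and ⇒ `HistoryWedge.WedgeTailL` (27959), by name -/

/-- ★★ **S1_log ⇒ `UnitScaleTilt.HistoryTailL`** (crux stmt-QuantumFields-19936 of the parent route, BY NAME): §1 then g5's
`historyTailL_of_largeFieldCount` (chessboard at separation `1`, exponential Chebyshev, the tree's per-plaquette schema with its `β^{A}`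
prefactor).  Conditional certificate: S1_log is OPEN; no rung or summit is proved. [cite: Balaban1985UV3, (7) p.257 and (71) p.273] -/
theorem historyTailL_of_unitLargeFieldCountLog
    (h : ∀ (L : ℕ) (b₀ p₀ : ℝ), 0 < b₀ → 2 < p₀ → ∃ (c₀ C₀ γ₁ : ℝ) (A : ℕ), 0 < c₀ ∧ 0 < γ₁ ∧ γ₁ ≤ 1 ∧
      ∀ (F : T3Family) (γ : ℝ), F.L = L → 0 < γ → γ ≤ γ₁ → ∀ (K : ℕ),
        ∫ U, Real.exp (c₀ * B10.pFun b₀ p₀ (Real.sqrt γ) ^ 2 *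
            ∑ a : Plaq (F.P K) K, (if T3UnitScaleTilt.θBal F.L γ b₀ p₀ 0 ≤ GaugeGroup.dist1 (GaugeField.plaqHol
              (Averaging.iter (fun i => BlockAveraging.blockAvg (P := F.P K) (j := i) T3UnitLawDensityEML.ℰp) K U) a)
              then (1 : ℝ) else 0)) ∂(T3UnitScaleTilt.gibbsK F T3UnitLawDensityEML.ℰp γ K) ≤
          Real.exp ((C₀ + A * Real.log γ⁻¹) * (Fintype.card (Plaq (F.P K) K) : ℝ))) :
    Summit.QuantumFields.YangMills.Theses.UnitScaleTilt.HistoryTailL :=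
  historyTailL_of_largeFieldCount (largeFieldCount_of_unitLargeFieldCountLog h)

/-- ★★ **S1_log ⇒ `HistoryWedge.WedgeTailL`** (crux stmt-QuantumFields-27959, the organ's FLOOR currency, BY NAME): §1, then g7's
`largeFieldCountW_of_largeFieldCount` and `wedgeTailL_of_largeFieldCountW`.  Conditional certificate; both sides stay OPEN.
[cite: Balaban1985UV3, (7) p.257 and (71) p.273] -/
theorem wedgeTailL_of_unitLargeFieldCountLog
    (h : ∀ (L : ℕ) (b₀ p₀ : ℝ), 0 < b₀ → 2 < p₀ → ∃ (c₀ C₀ γ₁ : ℝ) (A : ℕ), 0 < c₀ ∧ 0 < γ₁ ∧ γ₁ ≤ 1 ∧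
      ∀ (F : T3Family) (γ : ℝ), F.L = L → 0 < γ → γ ≤ γ₁ → ∀ (K : ℕ),
        ∫ U, Real.exp (c₀ * B10.pFun b₀ p₀ (Real.sqrt γ) ^ 2 *
            ∑ a : Plaq (F.P K) K, (if T3UnitScaleTilt.θBal F.L γ b₀ p₀ 0 ≤ GaugeGroup.dist1 (GaugeField.plaqHol
              (Averaging.iter (fun i => BlockAveraging.blockAvg (P := F.P K) (j := i) T3UnitLawDensityEML.ℰp) K U) a)
              then (1 : ℝ) else 0)) ∂(T3UnitScaleTilt.gibbsK F T3UnitLawDensityEML.ℰp γ K) ≤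
          Real.exp ((C₀ + A * Real.log γ⁻¹) * (Fintype.card (Plaq (F.P K) K) : ℝ))) :
    Summit.QuantumFields.YangMills.Theses.HistoryWedge.WedgeTailL :=
  wedgeTailL_of_largeFieldCountW (largeFieldCountW_of_largeFieldCount (largeFieldCount_of_unitLargeFieldCountLog h))

end Log

/-! ## §3 The registered EDGE stub S1_top ⇒ S1_log; the crux ⇒ S1_log; S1_top ALONE ⇒ `HistoryTailL` -/

section Top

/-- **S1_top ⇒ S1_log** (`A = 0`): the registered stub `stub_unitLargeFieldCount` of skeleton v9 is the slack-free case.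
[cite: Balaban1985UV3, (71) p.273] -/
theorem unitLargeFieldCountLog_of_unitLargeFieldCount
    (h : ∀ (L : ℕ) (b₀ p₀ : ℝ), 0 < b₀ → 2 < p₀ → ∃ (c₀ C₀ γ₁ : ℝ), 0 < c₀ ∧ 0 < γ₁ ∧ γ₁ ≤ 1 ∧
      ∀ (F : T3Family) (γ : ℝ), F.L = L → 0 < γ → γ ≤ γ₁ → ∀ (K : ℕ),
        ∫ U, Real.exp (c₀ * B10.pFun b₀ p₀ (Real.sqrt γ) ^ 2 *
            ∑ a : Plaq (F.P K) K, (if T3UnitScaleTilt.θBal F.L γ b₀ p₀ 0 ≤ GaugeGroup.dist1 (GaugeField.plaqHol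
              (Averaging.iter (fun i => BlockAveraging.blockAvg (P := F.P K) (j := i) T3UnitLawDensityEML.ℰp) K U) a)
              then (1 : ℝ) else 0)) ∂(T3UnitScaleTilt.gibbsK F T3UnitLawDensityEML.ℰp γ K) ≤
          Real.exp (C₀ * (Fintype.card (Plaq (F.P K) K) : ℝ))) :
    ∀ (L : ℕ) (b₀ p₀ : ℝ), 0 < b₀ → 2 < p₀ → ∃ (c₀ C₀ γ₁ : ℝ) (A : ℕ), 0 < c₀ ∧ 0 < γ₁ ∧ γ₁ ≤ 1 ∧
      ∀ (F : T3Family) (γ : ℝ), F.L = L → 0 < γ → γ ≤ γ₁ → ∀ (K : ℕ),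
        ∫ U, Real.exp (c₀ * B10.pFun b₀ p₀ (Real.sqrt γ) ^ 2 *
            ∑ a : Plaq (F.P K) K, (if T3UnitScaleTilt.θBal F.L γ b₀ p₀ 0 ≤ GaugeGroup.dist1 (GaugeField.plaqHol
              (Averaging.iter (fun i => BlockAveraging.blockAvg (P := F.P K) (j := i) T3UnitLawDensityEML.ℰp) K U) a)
              then (1 : ℝ) else 0)) ∂(T3UnitScaleTilt.gibbsK F T3UnitLawDensityEML.ℰp γ K) ≤
          Real.exp ((C₀ + A * Real.log γ⁻¹) * (Fintype.card (Plaq (F.P K) K) : ℝ)) := by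
  intro L b₀ p₀ hb₀ hp₀
  obtain ⟨c₀, C₀, γ₁, hc₀, hγ₁, hγ₁1, hTop⟩ := h L b₀ p₀ hb₀ hp₀
  refine ⟨c₀, C₀, γ₁, 0, hc₀, hγ₁, hγ₁1, fun F γ hFL hγ hγγ₁ K => ?_⟩
  have h0 : C₀ + ((0 : ℕ) : ℝ) * Real.log γ⁻¹ = C₀ := by rw [Nat.cast_zero, zero_mul, add_zero]
  rw [h0]
  exact hTop F γ hFL hγ hγγ₁ K

/-- **THE CRUX ⇒ S1_log**: `CappedCoarseStiffnessL` (stmt-QuantumFields-25301) ⇒ S1_top (g20's `unitStubs_of_cappedCoarseStiffnessL`, first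
conjunct) ⇒ S1_log.  S1_log is a FACTOR of the crux (strictly fewer demands: no BULK conjunct, logarithmic slack allowed).
[cite: Balaban1985UV3, (71) p.273] -/
theorem unitLargeFieldCountLog_of_cappedCoarseStiffnessL
    (h : Summit.QuantumFields.YangMills.Theses.CoarseStiffnessTail.CappedCoarseStiffnessL) :
    ∀ (L : ℕ) (b₀ p₀ : ℝ), 0 < b₀ → 2 < p₀ → ∃ (c₀ C₀ γ₁ : ℝ) (A : ℕ), 0 < c₀ ∧ 0 < γ₁ ∧ γ₁ ≤ 1 ∧
      ∀ (F : T3Family) (γ : ℝ), F.L = L → 0 < γ → γ ≤ γ₁ → ∀ (K : ℕ),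
        ∫ U, Real.exp (c₀ * B10.pFun b₀ p₀ (Real.sqrt γ) ^ 2 *
            ∑ a : Plaq (F.P K) K, (if T3UnitScaleTilt.θBal F.L γ b₀ p₀ 0 ≤ GaugeGroup.dist1 (GaugeField.plaqHol
              (Averaging.iter (fun i => BlockAveraging.blockAvg (P := F.P K) (j := i) T3UnitLawDensityEML.ℰp) K U) a)
              then (1 : ℝ) else 0)) ∂(T3UnitScaleTilt.gibbsK F T3UnitLawDensityEML.ℰp γ K) ≤
          Real.exp ((C₀ + A * Real.log γ⁻¹) * (Fintype.card (Plaq (F.P K) K) : ℝ)) :=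
  unitLargeFieldCountLog_of_unitLargeFieldCount (unitStubs_of_cappedCoarseStiffnessL h).1

/-- ★★ **THE REGISTERED EDGE STUB ALONE CLOSES 19936's DECL**: S1_top (`stub_unitLargeFieldCount` of skeleton v9, verbatim) ⇒
`UnitScaleTilt.HistoryTailL`, BY NAME — the BULK stub S2_top (`stub_unitSubThresholdStiffness`) is not read by the route's consumer.  (The
composition g20 `uniformLargeFieldCount_of_unitLargeFieldCount` + g5 `historyTailL_of_largeFieldCount` stated once, for the planners' re-type of
25301.)  Conditional certificate: S1_top is OPEN. [cite: Balaban1985UV3, (7) p.257 and (71) p.273] -/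
theorem historyTailL_of_unitLargeFieldCount
    (h : ∀ (L : ℕ) (b₀ p₀ : ℝ), 0 < b₀ → 2 < p₀ → ∃ (c₀ C₀ γ₁ : ℝ), 0 < c₀ ∧ 0 < γ₁ ∧ γ₁ ≤ 1 ∧
      ∀ (F : T3Family) (γ : ℝ), F.L = L → 0 < γ → γ ≤ γ₁ → ∀ (K : ℕ),
        ∫ U, Real.exp (c₀ * B10.pFun b₀ p₀ (Real.sqrt γ) ^ 2 *
            ∑ a : Plaq (F.P K) K, (if T3UnitScaleTilt.θBal F.L γ b₀ p₀ 0 ≤ GaugeGroup.dist1 (GaugeField.plaqHol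
              (Averaging.iter (fun i => BlockAveraging.blockAvg (P := F.P K) (j := i) T3UnitLawDensityEML.ℰp) K U) a)
              then (1 : ℝ) else 0)) ∂(T3UnitScaleTilt.gibbsK F T3UnitLawDensityEML.ℰp γ K) ≤
          Real.exp (C₀ * (Fintype.card (Plaq (F.P K) K) : ℝ))) :
    Summit.QuantumFields.YangMills.Theses.UnitScaleTilt.HistoryTailL :=
  historyTailL_of_unitLargeFieldCountLog (unitLargeFieldCountLog_of_unitLargeFieldCount h)

/-- **…and alone closes the organ's floor 27959** (`HistoryWedge.WedgeTailL`), BY NAME. [cite: Balaban1985UV3, (71) p.273] -/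
theorem wedgeTailL_of_unitLargeFieldCount
    (h : ∀ (L : ℕ) (b₀ p₀ : ℝ), 0 < b₀ → 2 < p₀ → ∃ (c₀ C₀ γ₁ : ℝ), 0 < c₀ ∧ 0 < γ₁ ∧ γ₁ ≤ 1 ∧
      ∀ (F : T3Family) (γ : ℝ), F.L = L → 0 < γ → γ ≤ γ₁ → ∀ (K : ℕ),
        ∫ U, Real.exp (c₀ * B10.pFun b₀ p₀ (Real.sqrt γ) ^ 2 *
            ∑ a : Plaq (F.P K) K, (if T3UnitScaleTilt.θBal F.L γ b₀ p₀ 0 ≤ GaugeGroup.dist1 (GaugeField.plaqHol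
              (Averaging.iter (fun i => BlockAveraging.blockAvg (P := F.P K) (j := i) T3UnitLawDensityEML.ℰp) K U) a)
              then (1 : ℝ) else 0)) ∂(T3UnitScaleTilt.gibbsK F T3UnitLawDensityEML.ℰp γ K) ≤
          Real.exp (C₀ * (Fintype.card (Plaq (F.P K) K) : ℝ))) :
    Summit.QuantumFields.YangMills.Theses.HistoryWedge.WedgeTailL :=
  wedgeTailL_of_unitLargeFieldCountLog (unitLargeFieldCountLog_of_unitLargeFieldCount h)

end Top

/-! ## §4 The history-wedge form S1_wedge: top couplings `≤ γ₁L^{-d}`, cut-offs `j` with `j + d ≤ m(d+1)`, depths `d ≥ i₀` -/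

section Wedge

/-- ★ **S1_wedge ⇒ LargeFieldCountW** (g7's hypothesis of `historyTailL_of_largeFieldCountW` / `wedgeTailL_of_largeFieldCountW`: the count bound
demanded only on the wedge `K ≤ m(K − j + 1)`, `1 ≤ j ≤ K`, only for depths `i₀ ≤ K − j`, `γ₁` after `m`, constants per `(F, γ, m)` — here uniform):
at height `j` of run `K = j + d` of `(F, γ)` the wedge guard reads `j + d ≤ m(d + 1)`, the depth is `d`, and the integral is the top-slice integral
of run `j` of `F.refine d` at `γL^{-d} ≤ γ₁L^{-d}` (§1's transport). [cite: Balaban1985UV3, (1)-(3) p.256 and (71) p.273; King1986, (3.12) p.657] -/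
theorem largeFieldCountW_of_unitLargeFieldCountWedge
    (h : ∀ (L : ℕ) (b₀ p₀ : ℝ), 0 < b₀ → 2 < p₀ → ∀ (m : ℕ), 0 < m → ∃ (c₀ C₀ γ₁ : ℝ) (A i₀ : ℕ), 0 < c₀ ∧ 0 < γ₁ ∧ γ₁ ≤ 1 ∧
      ∀ (F : T3Family) (γ : ℝ) (d : ℕ), F.L = L → 0 < γ → γ ≤ γ₁ * ((L : ℝ)⁻¹) ^ d → i₀ ≤ d → ∀ (j : ℕ), j + d ≤ m * (d + 1) →
        ∫ U, Real.exp (c₀ * B10.pFun b₀ p₀ (Real.sqrt γ) ^ 2 *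
            ∑ a : Plaq (F.P j) j, (if T3UnitScaleTilt.θBal F.L γ b₀ p₀ 0 ≤ GaugeGroup.dist1 (GaugeField.plaqHol
              (Averaging.iter (fun i => BlockAveraging.blockAvg (P := F.P j) (j := i) T3UnitLawDensityEML.ℰp) j U) a)
              then (1 : ℝ) else 0)) ∂(T3UnitScaleTilt.gibbsK F T3UnitLawDensityEML.ℰp γ j) ≤
          Real.exp ((C₀ + A * Real.log γ⁻¹) * (Fintype.card (Plaq (F.P j) j) : ℝ))) :
    ∀ (L : ℕ) (b₀ p₀ : ℝ), 0 < b₀ → 2 < p₀ → ∀ (m : ℕ), 0 < m → ∃ γ₁ : ℝ, 0 < γ₁ ∧ γ₁ ≤ 1 ∧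
      ∀ (F : T3Family) (γ : ℝ), F.L = L → 0 < γ → γ ≤ γ₁ → ∃ (c₀ C₀ : ℝ) (A i₀ : ℕ), 0 < c₀ ∧
        ∀ (K j : ℕ), 1 ≤ j → j ≤ K → K ≤ m * (K - j + 1) → i₀ ≤ K - j →
          ∫ U, Real.exp (c₀ * B10.pFun b₀ p₀ (Real.sqrt (γ * ((F.L : ℝ)⁻¹) ^ (K - j))) ^ 2 *
              ∑ a : Plaq (F.P K) j, (if T3UnitScaleTilt.θBal F.L γ b₀ p₀ (K - j) ≤ GaugeGroup.dist1 (GaugeField.plaqHol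
                (Averaging.iter (fun i => BlockAveraging.blockAvg (P := F.P K) (j := i) T3UnitLawDensityEML.ℰp) j U) a)
                then (1 : ℝ) else 0)) ∂(T3UnitScaleTilt.gibbsK F T3UnitLawDensityEML.ℰp γ K) ≤
            Real.exp ((C₀ + A * Real.log ((γ * ((F.L : ℝ)⁻¹) ^ (K - j))⁻¹)) * (Fintype.card (Plaq (F.P K) j) : ℝ)) := by
  intro L b₀ p₀ hb₀ hp₀ m hm
  obtain ⟨c₀, C₀, γ₁, A, i₀, hc₀, hγ₁, hγ₁1, hW⟩ := h L b₀ p₀ hb₀ hp₀ m hm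
  refine ⟨γ₁, hγ₁, hγ₁1, fun F γ hFL hγ hγγ₁ => ⟨c₀, C₀, A, i₀, hc₀, fun K j _hj1 hjK hwedge hi₀ => ?_⟩⟩
  obtain ⟨d, rfl⟩ := Nat.exists_eq_add_of_le hjK
  rw [Nat.add_sub_cancel_left] at hwedge hi₀
  obtain ⟨hγ', _hγ'le⟩ := coupling_refine_pos_le F hγ d
  have hγ'' : γ * ((F.L : ℝ)⁻¹) ^ d ≤ γ₁ * ((L : ℝ)⁻¹) ^ d := by
    rw [← hFL]
    exact mul_le_mul_of_nonneg_right hγγ₁ (pow_nonneg (inv_nonneg.mpr (Nat.cast_nonneg _)) d)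
  have key := hW (F.refine d) (γ * ((F.L : ℝ)⁻¹) ^ d) d hFL hγ' hγ'' hi₀ j hwedge
  rw [Nat.add_sub_cancel_left,
    integral_exp_plaqFun_eq_refine F hγ.le _ (fun u => if T3UnitScaleTilt.θBal F.L γ b₀ p₀ d ≤ GaugeGroup.dist1 u then (1 : ℝ) else 0),
    card_plaq_eq_refine, θBal_eq_θBal_refine_zero F.L γ b₀ p₀ d]
  exact key

/-- ★★ **S1_wedge ⇒ `UnitScaleTilt.HistoryTailL`** (19936, BY NAME): the previous theorem and g7's `historyTailL_of_largeFieldCountW`.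
Conditional certificate: S1_wedge is OPEN. [cite: Balaban1985UV3, (7) p.257 and (71) p.273; King1986, (3.12) p.657] -/
theorem historyTailL_of_unitLargeFieldCountWedge
    (h : ∀ (L : ℕ) (b₀ p₀ : ℝ), 0 < b₀ → 2 < p₀ → ∀ (m : ℕ), 0 < m → ∃ (c₀ C₀ γ₁ : ℝ) (A i₀ : ℕ), 0 < c₀ ∧ 0 < γ₁ ∧ γ₁ ≤ 1 ∧
      ∀ (F : T3Family) (γ : ℝ) (d : ℕ), F.L = L → 0 < γ → γ ≤ γ₁ * ((L : ℝ)⁻¹) ^ d → i₀ ≤ d → ∀ (j : ℕ), j + d ≤ m * (d + 1) →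
        ∫ U, Real.exp (c₀ * B10.pFun b₀ p₀ (Real.sqrt γ) ^ 2 *
            ∑ a : Plaq (F.P j) j, (if T3UnitScaleTilt.θBal F.L γ b₀ p₀ 0 ≤ GaugeGroup.dist1 (GaugeField.plaqHol
              (Averaging.iter (fun i => BlockAveraging.blockAvg (P := F.P j) (j := i) T3UnitLawDensityEML.ℰp) j U) a)
              then (1 : ℝ) else 0)) ∂(T3UnitScaleTilt.gibbsK F T3UnitLawDensityEML.ℰp γ j) ≤
          Real.exp ((C₀ + A * Real.log γ⁻¹) * (Fintype.card (Plaq (F.P j) j) : ℝ))) :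
    Summit.QuantumFields.YangMills.Theses.UnitScaleTilt.HistoryTailL :=
  historyTailL_of_largeFieldCountW (largeFieldCountW_of_unitLargeFieldCountWedge h)

/-- ★★ **S1_wedge ⇒ `HistoryWedge.WedgeTailL`** (27959, BY NAME): the transport and g7's `wedgeTailL_of_largeFieldCountW`.
Conditional certificate: S1_wedge is OPEN. [cite: Balaban1985UV3, (7) p.257 and (71) p.273] -/
theorem wedgeTailL_of_unitLargeFieldCountWedge
    (h : ∀ (L : ℕ) (b₀ p₀ : ℝ), 0 < b₀ → 2 < p₀ → ∀ (m : ℕ), 0 < m → ∃ (c₀ C₀ γ₁ : ℝ) (A i₀ : ℕ), 0 < c₀ ∧ 0 < γ₁ ∧ γ₁ ≤ 1 ∧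
      ∀ (F : T3Family) (γ : ℝ) (d : ℕ), F.L = L → 0 < γ → γ ≤ γ₁ * ((L : ℝ)⁻¹) ^ d → i₀ ≤ d → ∀ (j : ℕ), j + d ≤ m * (d + 1) →
        ∫ U, Real.exp (c₀ * B10.pFun b₀ p₀ (Real.sqrt γ) ^ 2 *
            ∑ a : Plaq (F.P j) j, (if T3UnitScaleTilt.θBal F.L γ b₀ p₀ 0 ≤ GaugeGroup.dist1 (GaugeField.plaqHol
              (Averaging.iter (fun i => BlockAveraging.blockAvg (P := F.P j) (j := i) T3UnitLawDensityEML.ℰp) j U) a)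
              then (1 : ℝ) else 0)) ∂(T3UnitScaleTilt.gibbsK F T3UnitLawDensityEML.ℰp γ j) ≤
          Real.exp ((C₀ + A * Real.log γ⁻¹) * (Fintype.card (Plaq (F.P j) j) : ℝ))) :
    Summit.QuantumFields.YangMills.Theses.HistoryWedge.WedgeTailL :=
  wedgeTailL_of_largeFieldCountW (largeFieldCountW_of_unitLargeFieldCountWedge h)

/-- **S1_log ⇒ S1_wedge** (drop the guards: same constants for every `m`, `i₀ = 0`; `γ ≤ γ₁L^{-d} ≤ γ₁` as `1 ≤ L`).  With §3:
`crux ⇒ S1_top ⇒ S1_log ⇒ S1_wedge`. [cite: Balaban1985UV3, (71) p.273] -/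
theorem unitLargeFieldCountWedge_of_unitLargeFieldCountLog
    (h : ∀ (L : ℕ) (b₀ p₀ : ℝ), 0 < b₀ → 2 < p₀ → ∃ (c₀ C₀ γ₁ : ℝ) (A : ℕ), 0 < c₀ ∧ 0 < γ₁ ∧ γ₁ ≤ 1 ∧
      ∀ (F : T3Family) (γ : ℝ), F.L = L → 0 < γ → γ ≤ γ₁ → ∀ (K : ℕ),
        ∫ U, Real.exp (c₀ * B10.pFun b₀ p₀ (Real.sqrt γ) ^ 2 *
            ∑ a : Plaq (F.P K) K, (if T3UnitScaleTilt.θBal F.L γ b₀ p₀ 0 ≤ GaugeGroup.dist1 (GaugeField.plaqHol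
              (Averaging.iter (fun i => BlockAveraging.blockAvg (P := F.P K) (j := i) T3UnitLawDensityEML.ℰp) K U) a)
              then (1 : ℝ) else 0)) ∂(T3UnitScaleTilt.gibbsK F T3UnitLawDensityEML.ℰp γ K) ≤
          Real.exp ((C₀ + A * Real.log γ⁻¹) * (Fintype.card (Plaq (F.P K) K) : ℝ))) :
    ∀ (L : ℕ) (b₀ p₀ : ℝ), 0 < b₀ → 2 < p₀ → ∀ (m : ℕ), 0 < m → ∃ (c₀ C₀ γ₁ : ℝ) (A i₀ : ℕ), 0 < c₀ ∧ 0 < γ₁ ∧ γ₁ ≤ 1 ∧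
      ∀ (F : T3Family) (γ : ℝ) (d : ℕ), F.L = L → 0 < γ → γ ≤ γ₁ * ((L : ℝ)⁻¹) ^ d → i₀ ≤ d → ∀ (j : ℕ), j + d ≤ m * (d + 1) →
        ∫ U, Real.exp (c₀ * B10.pFun b₀ p₀ (Real.sqrt γ) ^ 2 *
            ∑ a : Plaq (F.P j) j, (if T3UnitScaleTilt.θBal F.L γ b₀ p₀ 0 ≤ GaugeGroup.dist1 (GaugeField.plaqHol
              (Averaging.iter (fun i => BlockAveraging.blockAvg (P := F.P j) (j := i) T3UnitLawDensityEML.ℰp) j U) a)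
              then (1 : ℝ) else 0)) ∂(T3UnitScaleTilt.gibbsK F T3UnitLawDensityEML.ℰp γ j) ≤
          Real.exp ((C₀ + A * Real.log γ⁻¹) * (Fintype.card (Plaq (F.P j) j) : ℝ)) := by
  intro L b₀ p₀ hb₀ hp₀ m _hm
  obtain ⟨c₀, C₀, γ₁, A, hc₀, hγ₁, hγ₁1, hTop⟩ := h L b₀ p₀ hb₀ hp₀
  refine ⟨c₀, C₀, γ₁, A, 0, hc₀, hγ₁, hγ₁1, fun F γ d hFL hγ hγd _ j _ => ?_⟩
  have hL1 : (1 : ℝ) ≤ (L : ℝ) := by rw [← hFL]; exact_mod_cast F.hL.2.le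
  have hLinv : ((L : ℝ)⁻¹) ^ d ≤ 1 :=
    pow_le_one₀ (inv_nonneg.mpr (zero_le_one.trans hL1)) (inv_le_one_of_one_le₀ hL1)
  have hγγ₁ : γ ≤ γ₁ := hγd.trans (mul_le_of_le_one_right hγ₁.le hLinv)
  exact hTop F γ hFL hγ hγγ₁ j

end Wedge

/-! ## §5 The re-typed route's deciding theorems, kernel-checked: the parent's `closes` fed with an EDGE form in place of `HistoryTailL` -/

section Closes

/-- ★★★ **RUNG R3 FROM THE TWO RESIDUAL CRUXES AND S1_log** (the deciding theorem a re-typed route `CoarseStiffnessTail` would carry, already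
kernel-checked): the parent route's `UnitScaleTilt.closes` (rev 14) fed with its residual cruxes `MinimiserStabilityRegPr` (stmt-QuantumFields-19200)
and `FluctuationComparisonRegPrIntL` (stmt-QuantumFields-20520) and, in place of `HistoryTailL` (stmt-QuantumFields-19936), the EDGE form with
logarithmic slack S1_log through §2.  CONDITIONAL on three OPEN hypotheses; `YM3TorusSU2` is rung R3 (a RECORD rung: existence and uniqueness of
Bałaban's ultraviolet limit on the three-torus), NOT the Clay statement; nothing is proved unconditionally here. [cite: Balaban1985UV3, (71) p.273; King1986, Thm 3.4 p.656] -/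
theorem ym3TorusSU2_of_residuals_and_unitLargeFieldCountLog
    (h200 : Summit.QuantumFields.YangMills.Theses.UnitScaleTilt.MinimiserStabilityRegPr)
    (h201 : Summit.QuantumFields.YangMills.Theses.UnitScaleTilt.FluctuationComparisonRegPrIntL)
    (hS : ∀ (L : ℕ) (b₀ p₀ : ℝ), 0 < b₀ → 2 < p₀ → ∃ (c₀ C₀ γ₁ : ℝ) (A : ℕ), 0 < c₀ ∧ 0 < γ₁ ∧ γ₁ ≤ 1 ∧
      ∀ (F : T3Family) (γ : ℝ), F.L = L → 0 < γ → γ ≤ γ₁ → ∀ (K : ℕ),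
        ∫ U, Real.exp (c₀ * B10.pFun b₀ p₀ (Real.sqrt γ) ^ 2 *
            ∑ a : Plaq (F.P K) K, (if T3UnitScaleTilt.θBal F.L γ b₀ p₀ 0 ≤ GaugeGroup.dist1 (GaugeField.plaqHol
              (Averaging.iter (fun i => BlockAveraging.blockAvg (P := F.P K) (j := i) T3UnitLawDensityEML.ℰp) K U) a)
              then (1 : ℝ) else 0)) ∂(T3UnitScaleTilt.gibbsK F T3UnitLawDensityEML.ℰp γ K) ≤
          Real.exp ((C₀ + A * Real.log γ⁻¹) * (Fintype.card (Plaq (F.P K) K) : ℝ))) :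
    Literature.MathematicalPhysics.QuantumFieldTheory.Balaban1983to89.T3YM3TorusStatement.YM3TorusSU2 :=
  Summit.QuantumFields.YangMills.Theses.UnitScaleTilt.closes h200 h201 (historyTailL_of_unitLargeFieldCountLog hS)

/-- ★★★ **RUNG R3 FROM THE TWO RESIDUAL CRUXES AND THE REGISTERED EDGE STUB S1_top ALONE** (`stub_unitLargeFieldCount` of skeleton v9, signature
verbatim): `UnitScaleTilt.closes h200 h201 (historyTailL_of_unitLargeFieldCount hS)` — the BULK stub of 25301 is not used.  CONDITIONAL on three OPEN
hypotheses; rung R3 only, not Clay. [cite: Balaban1985UV3, (71) p.273; King1986, Thm 3.4 p.656] -/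
theorem ym3TorusSU2_of_residuals_and_unitLargeFieldCount
    (h200 : Summit.QuantumFields.YangMills.Theses.UnitScaleTilt.MinimiserStabilityRegPr)
    (h201 : Summit.QuantumFields.YangMills.Theses.UnitScaleTilt.FluctuationComparisonRegPrIntL)
    (hS : ∀ (L : ℕ) (b₀ p₀ : ℝ), 0 < b₀ → 2 < p₀ → ∃ (c₀ C₀ γ₁ : ℝ), 0 < c₀ ∧ 0 < γ₁ ∧ γ₁ ≤ 1 ∧
      ∀ (F : T3Family) (γ : ℝ), F.L = L → 0 < γ → γ ≤ γ₁ → ∀ (K : ℕ),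
        ∫ U, Real.exp (c₀ * B10.pFun b₀ p₀ (Real.sqrt γ) ^ 2 *
            ∑ a : Plaq (F.P K) K, (if T3UnitScaleTilt.θBal F.L γ b₀ p₀ 0 ≤ GaugeGroup.dist1 (GaugeField.plaqHol
              (Averaging.iter (fun i => BlockAveraging.blockAvg (P := F.P K) (j := i) T3UnitLawDensityEML.ℰp) K U) a)
              then (1 : ℝ) else 0)) ∂(T3UnitScaleTilt.gibbsK F T3UnitLawDensityEML.ℰp γ K) ≤
          Real.exp (C₀ * (Fintype.card (Plaq (F.P K) K) : ℝ))) :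
    Literature.MathematicalPhysics.QuantumFieldTheory.Balaban1983to89.T3YM3TorusStatement.YM3TorusSU2 :=
  Summit.QuantumFields.YangMills.Theses.UnitScaleTilt.closes h200 h201 (historyTailL_of_unitLargeFieldCount hS)

/-- **RUNG R3 FROM THE TWO RESIDUAL CRUXES AND S1_wedge** (the history-wedge form; §4).  CONDITIONAL; rung R3 only, not Clay.
[cite: Balaban1985UV3, (71) p.273; King1986, (3.12) p.657] -/
theorem ym3TorusSU2_of_residuals_and_unitLargeFieldCountWedge
    (h200 : Summit.QuantumFields.YangMills.Theses.UnitScaleTilt.MinimiserStabilityRegPr)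
    (h201 : Summit.QuantumFields.YangMills.Theses.UnitScaleTilt.FluctuationComparisonRegPrIntL)
    (hS : ∀ (L : ℕ) (b₀ p₀ : ℝ), 0 < b₀ → 2 < p₀ → ∀ (m : ℕ), 0 < m → ∃ (c₀ C₀ γ₁ : ℝ) (A i₀ : ℕ), 0 < c₀ ∧ 0 < γ₁ ∧ γ₁ ≤ 1 ∧
      ∀ (F : T3Family) (γ : ℝ) (d : ℕ), F.L = L → 0 < γ → γ ≤ γ₁ * ((L : ℝ)⁻¹) ^ d → i₀ ≤ d → ∀ (j : ℕ), j + d ≤ m * (d + 1) →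
        ∫ U, Real.exp (c₀ * B10.pFun b₀ p₀ (Real.sqrt γ) ^ 2 *
            ∑ a : Plaq (F.P j) j, (if T3UnitScaleTilt.θBal F.L γ b₀ p₀ 0 ≤ GaugeGroup.dist1 (GaugeField.plaqHol
              (Averaging.iter (fun i => BlockAveraging.blockAvg (P := F.P j) (j := i) T3UnitLawDensityEML.ℰp) j U) a)
              then (1 : ℝ) else 0)) ∂(T3UnitScaleTilt.gibbsK F T3UnitLawDensityEML.ℰp γ j) ≤
          Real.exp ((C₀ + A * Real.log γ⁻¹) * (Fintype.card (Plaq (F.P j) j) : ℝ))) :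
    Literature.MathematicalPhysics.QuantumFieldTheory.Balaban1983to89.T3YM3TorusStatement.YM3TorusSU2 :=
  Summit.QuantumFields.YangMills.Theses.UnitScaleTilt.closes h200 h201 (historyTailL_of_unitLargeFieldCountWedge hS)

end Closes

end Summit.QuantumFields.YangMills.Theorems.CoarseStiffnessTailUnitCountLogSlack

end
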